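import Literature.MathematicalPhysics.QuantumFieldTheory.Balaban1983to89.InfiniteVolumeSufficientXXI
import Literature.MathematicalPhysics.QuantumFieldTheory.Balaban1983to89.ClassLoopObservablesNotDenseSO8
import HarnessLib

/-!
# ORBIT SEPARATION BY A FAMILY OF FUNCTIONS OF THE LOOP HOLONOMIES IMPLIES DENSITY OF THEIR LOOP OBSERVABLES
# (module XXI PART C for an arbitrary family `χ : K → G → ℝ` in place of `Re/Im tr ρ`; [Levy2004] Props 3.4–3.6)

statement-level skeleton of published theorems with citation tags; proofs where landed; nothing here is a claim about
the Yang–Mills mass gap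

Cell `lit-balaban`, unit p24 gen 22, file A of the own-lane free target (G.5-34(d); no SKELETON row).  Module XXI
PART C (`traceWordsDense_of_traceWordsSeparateOrbits`, `spansGaugeInvariantCylinders_of_traceWordsSeparateOrbits`)
turns the ONE-REPRESENTATION orbit-separation schema `TraceWordsSeparateOrbits ρ` — equal `Re/Im tr ρ(w(V))` for all
words `w` forces simultaneous conjugacy — into module XIX's density schema `SpansGaugeInvariantCylinders d
(wilsonLoopProducts ρ d)` on `ℤ^d`.  For the even orthogonal groups that one-representation schema is FALSE in the
natural representation (`TraceWordsSeparateOrbitsEvenOrthogonal`, p340120), although for `SO(4)` conjugacy of all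
words DOES force simultaneous conjugacy (`Literature/LinearAlgebra/Matrix/SimultaneousConjugacySO4`,
`ProdConjDetermined SO(4)`; [Yu2021] Thm 1.1).  What is needed there is Lévy's own form of the hypothesis
([Levy2004] Prop. 3.4 p.5: «If g and g′ are two points of G^r such that for all word w in r letters and their
inverses, the elements w(g) and w(g′) of G are conjugate, then g and g′ belong to the same diagonal conjugacy class.»)
fed by ANY family of functions of the holonomy rich enough to detect conjugacy — not only `Re/Im tr ρ`.

THIS FILE proves module XXI PART C and module XX's reduction theorem for an ARBITRARY FAMILY `χ : K → G → ℝ`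
(`K` any index type) in place of `tracePart ρ : Bool → G → ℝ`; every proof is the lineage's proof with `Bool`
replaced by `K`, and for `χ = tracePart ρ` the new objects ARE the old ones (`rfl` bridges, §1/§3):

* §1 `classWordProduct χ l V = ∏ₖ χ_{kₖ}(wₖ(V))`, the class `classWordProducts χ ι` (multiplicatively closed);
* §2 **`classWordsDense_of_separatesOrbits`**: `G` compact, every `χ k` continuous, and the word values
  `(χ k (w V))_{w,k}` SEPARATE the simultaneous-conjugation orbits of `G^ι` for every finite `ι` ⟹ every continuous
  conjugation-invariant `f : (ι → G) → ℝ` is uniformly approximable by elements of `span_ℝ (classWordProducts χ ι)`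
  — real Stone–Weierstrass through the word map `V ↦ (χ k (w V))_{(w,k)}` onto its compact range, exactly as in
  XXI ([Levy2004] proof of Prop. 3.6 p.5: «Hence, Wilson loops separate the points on the configuration space.
  Since this space is compact, the result follows by the Stone-Weierstrass theorem.»);
* §3 the lattice class `loopClassProducts χ d` of all finite products of the loop observables `U ↦ χ_k(hol_ℓ(U))`
  (tree `wilsonLoopObs (χ k) ℓ`), `ℓ` based closed walks of `ℤ^d`: local, continuous, bounded; contained in gen 20's
  `classLoopProducts d G` when the `χ k` are class functions; `= wilsonLoopProducts ρ d` for `χ = tracePart ρ`;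
* §4 **`spansGaugeInvariantCylinders_of_classWordsDense`** (module XX's reduction theorem for `χ`: the lasso
  representation `F U = (cylSlice F S)(hol_U(lasso e))_{e ∈ S}` of a gauge-invariant cylinder and «words in lassos
  are loops», [Levy2004] Prop. 3.5) and **`spansGaugeInvariantCylinders_of_separatesOrbits`**: orbit separation by
  the family ⟹ `SpansGaugeInvariantCylinders d (loopClassProducts χ d)` in every dimension `d`;
* §5 **`hasUniqueInfiniteVolumeLimit_iff_tendsto_loopClassProduct`**: for the Wilson theory of any continuous `ρ`
  on such a `G`, `(3a)` (unique infinite-volume limit of the torus states) ⟺ every product of the loop observables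
  `χ_k(hol_ℓ)` has a thermodynamic limit of its torus expectations (module XIX HEADLINE 4 by name).

File B of this unit (`TracePfaffianLoopObservablesDenseSO4`) discharges the separation hypothesis for `G = SO(4)` and
`χ = {tr, p̃f}`.

HONEST SCOPE.  Pure reductions: nothing here asserts separation for any group; the separation HYPOTHESIS is the
conclusion of [Levy2004] Prop. 3.4 restricted to what the family `χ` sees; nothing about torus states at any `β`
beyond the equivalence of §5; NOT summit progress.

## References

* [Levy2004] T. Lévy, *Wilson loops in the light of spin networks*, J. Geom. Phys. 52 (2004) 382–397
  (arXiv:math-ph/0306059 pagination): Thm 3.1, Example 3.3, Props 3.4, 3.5, 3.6 (all p.5).  Held: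
  `paper:arxiv-math-ph_0306059`.
* [Sengupta1994] A. Sengupta, *Gauge invariant functions of connections*, Proc. AMS 121 (1994) 897–905, Thm 2 p.900.
-/

noncomputable section

open Filter Topology
open scoped Matrix

namespace Literature.MathematicalPhysics.QuantumFieldTheory.Balaban1983to89.ClassFunctionLoopObservablesDense

open Literature.MathematicalPhysics.QuantumLattice
open Literature.Probability.LatticeModels (zdGraph)
open Balaban1983to89.Missing (SpansGaugeInvariantCylinders)
open ClassLoopObservablesNotDenseSO8 (classLoopProducts)

universe u w

/-! ## §1 Products of functions of words -/

section Words

variable {G : Type u} [Group G] {K : Type w} (χ : K → G → ℝ)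

/-- A finite PRODUCT OF FUNCTIONS OF WORDS `V ↦ ∏ₖ χ_{kₖ}(wₖ(V))` (`1` for the empty list) — module XX's
`traceWordProduct ρ` with the family `Re/Im tr ρ` replaced by an arbitrary family `χ : K → G → ℝ`.
[cite: Levy2004, Prop 3.4 p.5] -/
def classWordProduct {ι : Type*} (l : List (List (ι × Bool) × K)) (V : ι → G) : ℝ :=
  (l.map fun p => χ p.2 (wordVal p.1 V)).prod

/-- The class of all finite products of functions of words in the variables indexed by `ι`. [cite: Levy2004, Prop 3.4 p.5] -/
def classWordProducts (ι : Type*) : Set ((ι → G) → ℝ) := Set.range (classWordProduct (ι := ι) χ)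

/-- `classWordProduct χ [] = 1`. [cite: Levy2004, Example 3.3 and Prop 3.4 p.5 (products of functions of the words w(g))] -/
@[simp] theorem classWordProduct_nil {ι : Type*} : classWordProduct (ι := ι) χ [] = fun _ => 1 := by
  funext V; simp [classWordProduct]

/-- `classWordProduct χ (p :: l) = (χ p.2 ∘ wordVal p.1) * classWordProduct χ l`. [cite: Levy2004, Example 3.3 and Prop 3.4 p.5 (products of functions of the words w(g))] -/
@[simp] theorem classWordProduct_cons {ι : Type*} (p : List (ι × Bool) × K) (l : List (List (ι × Bool) × K)) :
    classWordProduct χ (p :: l) = fun V => χ p.2 (wordVal p.1 V) * classWordProduct χ l V := by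
  funext V; simp [classWordProduct]

/-- Products of functions of words are closed under multiplication (concatenate the lists). [cite: Levy2004, Example 3.3 and Prop 3.4 p.5 (products of functions of the words w(g))] -/
theorem classWordProduct_append {ι : Type*} (l₁ l₂ : List (List (ι × Bool) × K)) :
    classWordProduct χ (l₁ ++ l₂) = classWordProduct χ l₁ * classWordProduct χ l₂ := by
  funext V; simp [classWordProduct, List.map_append, List.prod_append]

/-- The span of the products is closed under multiplication (a subalgebra). [cite: Levy2004, Example 3.3 and Prop 3.4 p.5 (products of functions of the words w(g))] -/
theorem mul_mem_span_classWordProducts {ι : Type*} {p q : (ι → G) → ℝ}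
    (hp : p ∈ Submodule.span ℝ (classWordProducts χ ι)) (hq : q ∈ Submodule.span ℝ (classWordProducts χ ι)) :
    p * q ∈ Submodule.span ℝ (classWordProducts χ ι) := by
  refine mul_mem_span_of_mul_closed (fun a ha b hb => ?_) hp hq
  obtain ⟨l₁, rfl⟩ := ha
  obtain ⟨l₂, rfl⟩ := hb
  exact ⟨l₁ ++ l₂, classWordProduct_append χ l₁ l₂⟩

/-- BRIDGE: for the family `Re/Im tr ρ` the products of functions of words ARE module XX's trace-word products.
[cite: Levy2004, Thm 3.1 p.5 (Wilson loops in the representation ρ: the family Re∕Im tr ρ)] -/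
theorem classWordProduct_tracePart {N : ℕ} (ρ : G →* Matrix (Fin N) (Fin N) ℂ) {ι : Type*}
    (l : List (List (ι × Bool) × Bool)) : classWordProduct (tracePart ρ) l = traceWordProduct ρ l := rfl

/-- BRIDGE: `classWordProducts (tracePart ρ) ι = traceWordProducts ρ ι`. [cite: Levy2004, Thm 3.1 p.5 (Wilson loops in the representation ρ: the family Re∕Im tr ρ)] -/
theorem classWordProducts_tracePart {N : ℕ} (ρ : G →* Matrix (Fin N) (Fin N) ℂ) (ι : Type*) :
    classWordProducts (tracePart ρ) ι = traceWordProducts ρ ι := rfl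

end Words

/-! ## §2 Orbit separation by the family implies density (real Stone–Weierstrass through the word map) -/

section OrbitStoneWeierstrass

variable {G : Type u} [Group G] {K : Type w} (χ : K → G → ℝ)

/-- THE WORD MAP of the family: `Φ : (ι → G) → ℝ^{words × K}`, `Φ(V)_{(w,k)} = χ_k(w(V))`. [cite: Levy2004, Prop 3.6 p.5 (proof: separation of points and Stone–Weierstrass)] -/
def classWordMap (ι : Type*) (V : ι → G) : List (ι × Bool) × K → ℝ := fun j => χ j.2 (wordVal j.1 V)

/-- `Φ V = Φ W` iff all the word values of `V` and `W` under the family agree. [cite: Levy2004, Prop 3.6 p.5 (proof: separation of points and Stone–Weierstrass)] -/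
theorem classWordMap_eq_iff {ι : Type*} (V W : ι → G) :
    classWordMap χ ι V = classWordMap χ ι W ↔
      ∀ (w : List (ι × Bool)) (k : K), χ k (wordVal w V) = χ k (wordVal w W) :=
  ⟨fun h w k => congr_fun h (w, k), fun h => funext fun j => h j.1 j.2⟩

/-- `Φ` is constant on simultaneous-conjugation orbits when the `χ k` are class functions. [cite: Levy2004, Remark 2.4 p.4 (invariance by diagonal adjunction)] -/
theorem classWordMap_conj (hχ : ∀ k a b, χ k (b * a * b⁻¹) = χ k a) {ι : Type*} (V : ι → G) (g : G) :
    classWordMap χ ι (fun i => g * V i * g⁻¹) = classWordMap χ ι V := by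
  funext j
  simp only [classWordMap, wordVal_conj, hχ]

/-- The coordinate functions of the range `Y = Φ(G^ι) ⊆ ℝ^J`, as continuous maps `Y → ℝ`. [cite: Levy2004, Prop 3.6 p.5 (proof: separation of points and Stone–Weierstrass)] -/
def rangeCoord (ι : Type*) (j : List (ι × Bool) × K) : C(↥(Set.range (classWordMap χ ι)), ℝ) :=
  ⟨fun y => (y : List (ι × Bool) × K → ℝ) j, (continuous_apply j).comp continuous_subtype_val⟩

/-- The coordinate functions separate the points of `Y` (tautologically), hence so does the unital real subalgebra
they generate. [cite: Levy2004, Prop 3.6 p.5 (proof: separation of points and Stone–Weierstrass)] -/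
theorem rangeCoord_separatesPoints (ι : Type*) :
    (Algebra.adjoin ℝ (Set.range (rangeCoord χ ι))).SeparatesPoints := by
  intro y y' hne
  have hne' : (y : List (ι × Bool) × K → ℝ) ≠ y' := fun h => hne (Subtype.ext h)
  obtain ⟨j, hj⟩ := Function.ne_iff.1 hne'
  exact ⟨rangeCoord χ ι j, ⟨rangeCoord χ ι j, Algebra.subset_adjoin ⟨j, rfl⟩, rfl⟩, hj⟩

/-- PULL-BACK: every element of the coordinate algebra of `Y`, precomposed with `Φ`, is (as a function on `ι → G`)
in the real span of the products of functions of words (a coordinate pulls back to a single factor; constants, sums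
and products). [cite: Levy2004, Prop 3.6 p.5 (proof: separation of points and Stone–Weierstrass)] -/
theorem comp_classWordMap_mem_span {ι : Type*} {q : C(↥(Set.range (classWordMap χ ι)), ℝ)}
    (hq : q ∈ Algebra.adjoin ℝ (Set.range (rangeCoord χ ι))) :
    (fun V : ι → G => q ⟨classWordMap χ ι V, Set.mem_range_self V⟩) ∈
      Submodule.span ℝ (classWordProducts χ ι) := by
  induction hq using Algebra.adjoin_induction with
  | mem x hx =>
    obtain ⟨j, rfl⟩ := hx
    refine Submodule.subset_span ⟨[j], ?_⟩
    funext V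
    simp [classWordProduct, rangeCoord, classWordMap]
  | algebraMap r =>
    have h : (fun V : ι → G => (algebraMap ℝ C(↥(Set.range (classWordMap χ ι)), ℝ) r)
        ⟨classWordMap χ ι V, Set.mem_range_self V⟩) = r • classWordProduct (ι := ι) χ [] := by
      funext V
      simp [Algebra.algebraMap_eq_smul_one]
    rw [h]
    exact Submodule.smul_mem _ r (Submodule.subset_span ⟨[], rfl⟩)
  | add x y _ _ hx hy =>
    have h : (fun V : ι → G => (x + y) ⟨classWordMap χ ι V, Set.mem_range_self V⟩) =
        (fun V => x ⟨classWordMap χ ι V, Set.mem_range_self V⟩) +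
          fun V => y ⟨classWordMap χ ι V, Set.mem_range_self V⟩ := by
      funext V; simp
    rw [h]
    exact Submodule.add_mem _ hx hy
  | mul x y _ _ hx hy =>
    have h : (fun V : ι → G => (x * y) ⟨classWordMap χ ι V, Set.mem_range_self V⟩) =
        (fun V => x ⟨classWordMap χ ι V, Set.mem_range_self V⟩) *
          fun V => y ⟨classWordMap χ ι V, Set.mem_range_self V⟩ := by
      funext V; simp
    rw [h]
    exact mul_mem_span_classWordProducts χ hx hy

variable [TopologicalSpace G] [IsTopologicalGroup G]

/-- `Φ` is continuous when every `χ k` is. [cite: Levy2004, Prop 3.6 p.5 (proof: separation of points and Stone–Weierstrass)] -/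
theorem continuous_classWordMap (hχc : ∀ k, Continuous (χ k)) (ι : Type*) : Continuous (classWordMap χ ι) :=
  continuous_pi fun j => (hχc j.2).comp (continuous_wordVal j.1)

variable [CompactSpace G]

/-- **ORBIT SEPARATION BY THE FAMILY IMPLIES DENSITY (real Stone–Weierstrass through the word map).**  Let `G` be a
compact group and `χ : K → G → ℝ` a family of continuous functions such that, for every finite `ι`, the word values
`χ_k(w(V))` (all words `w` in the letters `i^{±1}`, all `k`) separate the simultaneous-conjugation orbits of `G^ι`
(«if … for all word w … the elements w(g) and w(g′) of G are conjugate, then g and g′ belong to the same diagonal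
conjugacy class», [Levy2004] Prop. 3.4, as detected by `χ`).  Then every continuous conjugation-invariant
`f : (ι → G) → ℝ` is, for every `ε > 0`, within `ε` in sup norm of a real linear combination of products of the
`χ_k ∘ w`: `f` is constant on the fibres of the word map `Φ` (fibres ⊆ orbits, by separation), so `f = f̄ ∘ Φ` with
`f̄` continuous on the compact Hausdorff range `Y = Φ(G^ι)` (`Φ : G^ι → Y` is a closed continuous surjection, hence a
quotient map); the coordinates separate the points of `Y`; apply
`ContinuousMap.exists_mem_subalgebra_near_continuous_of_separatesPoints` and pull back.  Module XXI PART C is the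
case `χ = tracePart ρ`. [cite: Levy2004, Props 3.4–3.6 p.5] -/
theorem classWordsDense_of_separatesOrbits (hχc : ∀ k, Continuous (χ k))
    (hsep : ∀ (ι : Type) [Fintype ι] (V W : ι → G),
      (∀ (w : List (ι × Bool)) (k : K), χ k (wordVal w V) = χ k (wordVal w W)) → ∃ g : G, ∀ i, W i = g * V i * g⁻¹)
    (ι : Type) [Fintype ι] (f : (ι → G) → ℝ) (hf : Continuous f)
    (hfinv : ∀ (g : G) (V : ι → G), f (fun i => g * V i * g⁻¹) = f V) (ε : ℝ) (hε : 0 < ε) :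
    ∃ p ∈ Submodule.span ℝ (classWordProducts χ ι), ∀ V, |f V - p V| ≤ ε := by
  classical
  let Y : Set (List (ι × Bool) × K → ℝ) := Set.range (classWordMap χ ι)
  have hΦc : Continuous (classWordMap χ ι) := continuous_classWordMap χ hχc ι
  haveI : CompactSpace ↥Y := isCompact_iff_compactSpace.1 (isCompact_range hΦc)
  let π : (ι → G) → ↥Y := fun V => ⟨classWordMap χ ι V, Set.mem_range_self V⟩
  have hπc : Continuous π := hΦc.subtype_mk _
  have hπs : Function.Surjective π := by
    rintro ⟨y, V, rfl⟩
    exact ⟨V, rfl⟩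
  -- `f` is constant on the fibres of `Φ` (⊆ the orbits)
  have hfib : ∀ V W : ι → G, classWordMap χ ι V = classWordMap χ ι W → f V = f W := by
    intro V W h
    obtain ⟨g, hg⟩ := hsep ι V W ((classWordMap_eq_iff χ V W).1 h)
    rw [show W = fun i => g * V i * g⁻¹ from funext hg, hfinv]
  -- the factorisation `f = fbar ∘ π`
  let fbar : ↥Y → ℝ := fun y => f (Classical.choose y.2)
  have hfbar : ∀ V, fbar (π V) = f V := fun V =>
    hfib _ _ (Classical.choose_spec (π V).2)
  have hfbar_c : Continuous fbar := by
    rw [((hπc.isClosedMap).isQuotientMap hπc hπs).continuous_iff, show fbar ∘ π = f from funext hfbar]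
    exact hf
  obtain ⟨q, hq⟩ := ContinuousMap.exists_mem_subalgebra_near_continuous_of_separatesPoints
    (Algebra.adjoin ℝ (Set.range (rangeCoord χ ι))) (rangeCoord_separatesPoints χ ι) fbar hfbar_c ε hε
  refine ⟨fun V => (q : C(↥Y, ℝ)) (π V), comp_classWordMap_mem_span χ q.2, fun V => ?_⟩
  have h := hq (π V)
  rw [hfbar, Real.norm_eq_abs, abs_sub_comm] at h
  exact h.le

end OrbitStoneWeierstrass

/-! ## §3 The lattice class: products of the loop observables `U ↦ χ_k(hol_ℓ(U))` -/

section LatticeClass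

variable {d : ℕ} {G : Type u} [Group G] {K : Type w} (χ : K → G → ℝ)

/-- A generator: the loop observable `U ↦ χ_k(hol_ℓ(U))` of the based closed walk `ℓ` and the function `χ k`
(tree `wilsonLoopObs (χ k) ℓ`). [cite: Levy2004, §2 p.4 (conjugation-invariant functions of the holonomy)] -/
def loopClassFactor (p : (Σ x : (Fin d → ℤ), (zdGraph d).Walk x x) × K) (U : LGConfig d G) : ℝ :=
  wilsonLoopObs (χ p.2) p.1.2 U

/-- `loopClassFactor χ (ℓ, k) U = χ k (hol_ℓ U)`. [cite: Levy2004, §2 p.4 and Remark 2.4 (f ∘ (h_{l_1}, …, h_{l_n}), continuous functions of the holonomies)] -/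
@[simp] theorem loopClassFactor_apply (p : (Σ x : (Fin d → ℤ), (zdGraph d).Walk x x) × K) (U : LGConfig d G) :
    loopClassFactor χ p U = χ p.2 (walkHolonomy U p.1.2) := rfl

/-- A finite PRODUCT of generators `U ↦ ∏ₖ χ_{kₖ}(hol_{ℓₖ}(U))` (`1` for the empty list). [cite: Levy2004, Thm 3.1 p.5 (the algebra generated by the loop observables)] -/
def loopClassProduct (l : List ((Σ x : (Fin d → ℤ), (zdGraph d).Walk x x) × K)) (U : LGConfig d G) : ℝ :=
  (l.map fun p => loopClassFactor χ p U).prod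

/-- **The lattice class of the family `χ` on `ℤ^d`**: all finite products of the loop observables `χ_k(hol_ℓ)`.
[cite: Levy2004, Thm 3.1 p.5] -/
def loopClassProducts (d : ℕ) : Set (LGConfig d G → ℝ) := Set.range (loopClassProduct (d := d) χ)

/-- `loopClassProduct χ [] = 1`. [cite: Levy2004, §2 p.4 and Remark 2.4 (f ∘ (h_{l_1}, …, h_{l_n}), continuous functions of the holonomies)] -/
@[simp] theorem loopClassProduct_nil : loopClassProduct (d := d) χ [] = fun _ => 1 := by
  funext U; simp [loopClassProduct]

/-- `loopClassProduct χ (p :: l) = loopClassFactor χ p * loopClassProduct χ l`. [cite: Levy2004, §2 p.4 and Remark 2.4 (f ∘ (h_{l_1}, …, h_{l_n}), continuous functions of the holonomies)] -/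
@[simp] theorem loopClassProduct_cons (p : (Σ x : (Fin d → ℤ), (zdGraph d).Walk x x) × K)
    (l : List ((Σ x : (Fin d → ℤ), (zdGraph d).Walk x x) × K)) :
    loopClassProduct χ (p :: l) = fun U => loopClassFactor χ p U * loopClassProduct χ l U := by
  funext U; simp [loopClassProduct]

/-- `loopClassProduct χ l ∈ loopClassProducts χ d`. [cite: Levy2004, §2 p.4 and Remark 2.4 (f ∘ (h_{l_1}, …, h_{l_n}), continuous functions of the holonomies)] -/
theorem loopClassProduct_mem (l : List ((Σ x : (Fin d → ℤ), (zdGraph d).Walk x x) × K)) :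
    loopClassProduct χ l ∈ loopClassProducts χ d := ⟨l, rfl⟩

/-- BRIDGE: for `χ = tracePart ρ` the generators ARE module XIX's Wilson-loop generators. [cite: Levy2004, Thm 3.1 p.5 (Wilson loops in the representation ρ: the family Re∕Im tr ρ)] -/
theorem loopClassFactor_tracePart {N : ℕ} (ρ : G →* Matrix (Fin N) (Fin N) ℂ)
    (p : (Σ x : (Fin d → ℤ), (zdGraph d).Walk x x) × Bool) : loopClassFactor (tracePart ρ) p = loopFactor ρ p := by
  funext U
  rcases p with ⟨ℓ, b⟩
  rw [loopClassFactor_apply, loopFactor_eq_tracePart]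

/-- BRIDGE: `loopClassProduct (tracePart ρ) l = loopProduct ρ l`. [cite: Levy2004, Thm 3.1 p.5 (Wilson loops in the representation ρ: the family Re∕Im tr ρ)] -/
theorem loopClassProduct_tracePart {N : ℕ} (ρ : G →* Matrix (Fin N) (Fin N) ℂ) :
    ∀ l : List ((Σ x : (Fin d → ℤ), (zdGraph d).Walk x x) × Bool), loopClassProduct (tracePart ρ) l = loopProduct ρ l
  | [] => by rw [loopClassProduct_nil, loopProduct_nil]
  | p :: l => by rw [loopClassProduct_cons, loopProduct_cons, loopClassFactor_tracePart, loopClassProduct_tracePart ρ l]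

/-- BRIDGE: `loopClassProducts (tracePart ρ) d = wilsonLoopProducts ρ d` (Lévy's class in the representation `ρ`).
[cite: Levy2004, Thm 3.1 p.5 (Wilson loops in the representation ρ: the family Re∕Im tr ρ)] -/
theorem loopClassProducts_tracePart {N : ℕ} (ρ : G →* Matrix (Fin N) (Fin N) ℂ) :
    loopClassProducts (tracePart ρ) d = wilsonLoopProducts ρ d := by
  ext W
  constructor
  · rintro ⟨l, rfl⟩; exact ⟨l, (loopClassProduct_tracePart ρ l).symm⟩
  · rintro ⟨l, rfl⟩; exact ⟨l, loopClassProduct_tracePart ρ l⟩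

/-- When the `χ k` are CLASS FUNCTIONS the lattice class is contained in gen 20's class `classLoopProducts d G` of all
products of class-function loop observables. [cite: Levy2004, §2 p.4] -/
theorem loopClassProducts_subset_classLoopProducts (hχ : ∀ k a b, χ k (b * a * b⁻¹) = χ k a) :
    loopClassProducts χ d ⊆ classLoopProducts d G := by
  rintro W ⟨l, rfl⟩
  refine ⟨l.map fun p => (p.1, χ p.2), fun q hq a b => ?_, ?_⟩
  · obtain ⟨p, _, rfl⟩ := List.mem_map.1 hq
    exact hχ p.2 a b
  · funext U
    simp only [loopClassProduct, List.map_map, Function.comp_def, loopClassFactor_apply]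

/-- Every product of generators is a local observable (support: the union of the loop supports). [cite: Levy2004, §2 p.4 and Remark 2.4 (f ∘ (h_{l_1}, …, h_{l_n}), continuous functions of the holonomies)] -/
theorem isLocalObservable_loopClassProduct :
    ∀ l : List ((Σ x : (Fin d → ℤ), (zdGraph d).Walk x x) × K), IsLocalObservable (loopClassProduct (d := d) χ l)
  | [] => ⟨∅, fun U U' _ => by simp⟩
  | p :: l => by
    classical
    obtain ⟨S₁, h₁⟩ : IsLocalObservable (loopClassFactor (d := d) χ p) := ⟨_, isCylinder_wilsonLoopObs (χ p.2) p.1.2⟩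
    obtain ⟨S₂, h₂⟩ := isLocalObservable_loopClassProduct l
    refine ⟨S₁ ∪ S₂, fun U U' hUU' => ?_⟩
    simp only [loopClassProduct_cons]
    rw [h₁ fun e he => hUU' e (by simp only [Finset.coe_union, Set.mem_union]; exact Or.inl he),
      h₂ fun e he => hUU' e (by simp only [Finset.coe_union, Set.mem_union]; exact Or.inr he)]

variable [TopologicalSpace G] [IsTopologicalGroup G]

/-- Every product of generators is continuous (continuous `χ k`). [cite: Levy2004, §2 p.4 and Remark 2.4 (f ∘ (h_{l_1}, …, h_{l_n}), continuous functions of the holonomies)] -/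
theorem continuous_loopClassProduct (hχc : ∀ k, Continuous (χ k)) :
    ∀ l : List ((Σ x : (Fin d → ℤ), (zdGraph d).Walk x x) × K), Continuous (loopClassProduct (d := d) χ l)
  | [] => by rw [loopClassProduct_nil]; exact continuous_const
  | p :: l => by
    rw [loopClassProduct_cons]
    exact (continuous_wilsonLoopObs (hχc p.2) p.1.2).mul (continuous_loopClassProduct hχc l)

variable [CompactSpace G]

omit [IsTopologicalGroup G] in
/-- Every product of generators is bounded (compact `G`, continuous `χ k`). [cite: Levy2004, §2 p.4 and Remark 2.4 (f ∘ (h_{l_1}, …, h_{l_n}), continuous functions of the holonomies)] -/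
theorem exists_abs_loopClassProduct_le (hχc : ∀ k, Continuous (χ k)) :
    ∀ l : List ((Σ x : (Fin d → ℤ), (zdGraph d).Walk x x) × K), ∃ C, ∀ U, |loopClassProduct (d := d) χ l U| ≤ C
  | [] => ⟨1, fun U => by simp⟩
  | p :: l => by
    obtain ⟨C₁, h₁⟩ := exists_abs_wilsonLoopObs_le (d := d) (hχc p.2) p.1.2
    obtain ⟨C₂, h₂⟩ := exists_abs_loopClassProduct_le hχc l
    refine ⟨C₁ * C₂, fun U => ?_⟩
    rw [loopClassProduct_cons, abs_mul]
    exact mul_le_mul (h₁ U) (h₂ U) (abs_nonneg _) ((abs_nonneg _).trans (h₁ U))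

end LatticeClass

/-! ## §4 Words in lassos: module XX's reduction theorem for the family `χ` -/

section Reduction

variable {d : ℕ} {G : Type u} [Group G] {K : Type w} (χ : K → G → ℝ)

/-- The list of based loops at the origin attached to a list of words in the edges of `S`: each word is spelled in
the lassos of its letters (module XX `wordLasso`). [cite: Levy2004, Prop 3.5 p.5] -/
def loopsOfClassWords (S : Finset (ZdEdge d)) (l : List (List (↥S × Bool) × K)) :
    List ((Σ x : (Fin d → ℤ), (zdGraph d).Walk x x) × K) :=
  l.map fun p => (⟨0, wordLasso (p.1.map fun a => ((a.1 : ZdEdge d), a.2))⟩, p.2)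

/-- A product of functions of words in the variables `e ∈ S`, evaluated at the lasso holonomies, IS a product of loop
observables of the family («words in lassos are loops», module XX `walkHolonomy_wordLasso`). [cite: Levy2004, Props 3.5–3.6 p.5] -/
theorem classWordProduct_lassoConfig (S : Finset (ZdEdge d)) :
    ∀ (l : List (List (↥S × Bool) × K)) (U : LGConfig d G),
      classWordProduct χ l (fun e : ↥S => lassoConfig U (e : ZdEdge d)) = loopClassProduct χ (loopsOfClassWords S l) U
  | [], U => by simp [loopsOfClassWords]
  | p :: l, U => by
    have ih := classWordProduct_lassoConfig S l U
    simp only [loopsOfClassWords, List.map_cons, classWordProduct_cons, loopClassProduct_cons] at ih ⊢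
    rw [loopClassFactor_apply, walkHolonomy_wordLasso, wordVal_map Subtype.val, ← ih]
    rfl

/-- Hence precomposition with the lasso holonomies maps `classWordProducts χ ↥S` into `loopClassProducts χ d`.
[cite: Levy2004, Props 3.5–3.6 p.5] -/
theorem classWordProduct_lassoConfig_mem (S : Finset (ZdEdge d)) {q : (↥S → G) → ℝ}
    (hq : q ∈ classWordProducts χ ↥S) :
    (fun U : LGConfig d G => q fun e : ↥S => lassoConfig U (e : ZdEdge d)) ∈ loopClassProducts χ d := by
  obtain ⟨l, rfl⟩ := hq
  exact ⟨loopsOfClassWords S l, by funext U; exact (classWordProduct_lassoConfig χ S l U).symm⟩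

/-- … and the span into the span (precomposition is linear). [cite: Levy2004, Props 3.5–3.6 p.5 (words in lassos are loops)] -/
theorem comp_lassoConfig_mem_span (S : Finset (ZdEdge d)) {p : (↥S → G) → ℝ}
    (hp : p ∈ Submodule.span ℝ (classWordProducts χ ↥S)) :
    (fun U : LGConfig d G => p fun e : ↥S => lassoConfig U (e : ZdEdge d)) ∈
      Submodule.span ℝ (loopClassProducts χ d) := by
  let Λ : ((↥S → G) → ℝ) →ₗ[ℝ] (LGConfig d G → ℝ) :=
    LinearMap.funLeft ℝ ℝ fun (U : LGConfig d G) (e : ↥S) => lassoConfig U (e : ZdEdge d)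
  have h := Submodule.apply_mem_span_image_of_mem_span Λ hp
  refine Submodule.span_mono ?_ h
  rintro _ ⟨q, hq, rfl⟩
  exact classWordProduct_lassoConfig_mem χ S hq

variable [TopologicalSpace G]

/-- **MODULE XX'S REDUCTION THEOREM FOR THE FAMILY `χ`.**  If, for every finite index type, the continuous
conjugation-invariant functions of several group elements are uniformly approximable by the span of
`classWordProducts χ`, then on `ℤ^d`, in every dimension, the real span of the products of the loop observables
`χ_k(hol_ℓ)` is uniformly dense in the gauge-invariant bounded continuous cylinder observables
(`SpansGaugeInvariantCylinders d (loopClassProducts χ d)`): approximate the slice `cylSlice F S` and precompose with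
the lasso holonomies (`eq_cylSlice_lasso`). [cite: Levy2004, Thm 3.1 and Props 3.4–3.6 p.5] -/
theorem spansGaugeInvariantCylinders_of_classWordsDense
    (h : ∀ (ι : Type) [Fintype ι] (f : (ι → G) → ℝ), Continuous f →
      (∀ (g : G) (V : ι → G), f (fun i => g * V i * g⁻¹) = f V) →
        ∀ ε : ℝ, 0 < ε → ∃ p ∈ Submodule.span ℝ (classWordProducts χ ι), ∀ V, |f V - p V| ≤ ε) :
    SpansGaugeInvariantCylinders d (loopClassProducts χ d) := by
  intro F S hFS hFc _ hFg ε hε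
  obtain ⟨p, hp, hclose⟩ :=
    h ↥S (cylSlice F S) (continuous_cylSlice hFc S) (fun g V => cylSlice_conj hFg S V g) ε hε
  refine ⟨fun U => p fun e : ↥S => lassoConfig U (e : ZdEdge d), comp_lassoConfig_mem_span χ S hp, fun U => ?_⟩
  rw [eq_cylSlice_lasso hFS hFg U]
  exact hclose _

variable [IsTopologicalGroup G] [CompactSpace G]

/-- **ORBIT SEPARATION BY THE FAMILY IMPLIES LÉVY'S DENSITY ON `ℤ^d`, in every dimension.**  For a compact group `G`
and continuous `χ_k` whose word values separate the simultaneous-conjugation orbits, the products of the loop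
observables `χ_k(hol_ℓ)` span: `SpansGaugeInvariantCylinders d (loopClassProducts χ d)`.
[cite: Levy2004, Thm 3.1 and Props 3.4–3.6 p.5] -/
theorem spansGaugeInvariantCylinders_of_separatesOrbits (hχc : ∀ k, Continuous (χ k))
    (hsep : ∀ (ι : Type) [Fintype ι] (V W : ι → G),
      (∀ (w : List (ι × Bool)) (k : K), χ k (wordVal w V) = χ k (wordVal w W)) → ∃ g : G, ∀ i, W i = g * V i * g⁻¹)
    (d : ℕ) : SpansGaugeInvariantCylinders d (loopClassProducts χ d) :=
  spansGaugeInvariantCylinders_of_classWordsDense χ fun ι _ f hf hfinv ε hε =>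
    classWordsDense_of_separatesOrbits χ hχc hsep ι f hf hfinv ε hε

/-- In particular gen 20's class of ALL class-function loop products spans as soon as ONE separating family of
continuous class functions does (monotonicity of the schema). [cite: Levy2004, Thm 3.1 p.5] -/
theorem spansGaugeInvariantCylinders_classLoopProducts_of_separatesOrbits (hχc : ∀ k, Continuous (χ k))
    (hχ : ∀ k a b, χ k (b * a * b⁻¹) = χ k a)
    (hsep : ∀ (ι : Type) [Fintype ι] (V W : ι → G),
      (∀ (w : List (ι × Bool)) (k : K), χ k (wordVal w V) = χ k (wordVal w W)) → ∃ g : G, ∀ i, W i = g * V i * g⁻¹)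
    (d : ℕ) : SpansGaugeInvariantCylinders d (classLoopProducts d G) :=
  spansGaugeInvariantCylinders_mono (Submodule.span_mono (loopClassProducts_subset_classLoopProducts χ hχ))
    (spansGaugeInvariantCylinders_of_separatesOrbits χ hχc hsep d)

end Reduction

/-! ## §5 The infinite-volume consequence: `(3a)` ⟺ the loop correlations of the family converge -/

section InfiniteVolume

variable {d N : ℕ} {G : Type u} [Group G] [TopologicalSpace G] [IsTopologicalGroup G] [CompactSpace G]
  [MeasurableSpace G] [BorelSpace G] [SecondCountableTopology G] [T2Space G]
  (ρ : G →* Matrix (Fin N) (Fin N) ℂ) {K : Type w} (χ : K → G → ℝ)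

/-- **`(3a)` ⟺ EVERY LOOP CORRELATION OF THE FAMILY HAS A THERMODYNAMIC LIMIT.**  For the Wilson lattice gauge
theory of a continuous representation `ρ` of a compact metrisable group `G` (any real `β`, any `d`) and a family
`χ` of continuous functions whose word values separate the simultaneous-conjugation orbits: the torus states have a
unique infinite-volume limit iff for every finite list of based loops `ℓ_j` and indices `k_j` the torus expectation
`⟨∏_j χ_{k_j}(hol_{ℓ_j})⟩_{𝕋_{L+1},β}` converges as `L → ∞` (module XIX HEADLINE 4 for the dense class
`loopClassProducts χ d`). [cite: Levy2004, Thm 3.1 p.5] -/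
theorem hasUniqueInfiniteVolumeLimit_iff_tendsto_loopClassProduct (hρ : Continuous ρ) (β : ℝ)
    (hχc : ∀ k, Continuous (χ k))
    (hsep : ∀ (ι : Type) [Fintype ι] (V W : ι → G),
      (∀ (w : List (ι × Bool)) (k : K), χ k (wordVal w V) = χ k (wordVal w W)) → ∃ g : G, ∀ i, W i = g * V i * g⁻¹) :
    HasUniqueInfiniteVolumeLimit (d := d) ρ β ↔
      ∀ l : List ((Σ x : (Fin d → ℤ), (zdGraph d).Walk x x) × K), ∃ lim : ℝ,
        Tendsto (fun L : ℕ => wilsonExpectation (L := L + 1) ρ β (toTorusObservable (L + 1) (loopClassProduct χ l)))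
          atTop (𝓝 lim) := by
  have h𝒲 : ∀ W ∈ loopClassProducts χ d, IsLocalObservable W ∧ Measurable W ∧ ∃ C, ∀ U, |W U| ≤ C := by
    rintro W ⟨l, rfl⟩
    exact ⟨isLocalObservable_loopClassProduct χ l, (continuous_loopClassProduct χ hχc l).measurable,
      exists_abs_loopClassProduct_le χ hχc l⟩
  rw [hasUniqueInfiniteVolumeLimit_iff_tendsto_of_spans ρ hρ β h𝒲
    (spansGaugeInvariantCylinders_of_separatesOrbits χ hχc hsep d)]
  simp only [loopClassProducts, Set.forall_mem_range]

end InfiniteVolume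

end Literature.MathematicalPhysics.QuantumFieldTheory.Balaban1983to89.ClassFunctionLoopObservablesDense
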